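/-
Copyright (c) 2026 the pub-hodgecm-mathlib formalisation cell (harness21).  Prover seat hodgecm-mathlib-LH4-p18 (g4), req620 Track A «(D-RAM) FOUR-FRAME» squad
(STAGE-1b, row (2) of the piece `f_{T₊}`, the (β₂) road (R-36); β₂ sub-dealer LH4-p04 (g10) WORD #30 «p18: K6-(a) (hF) ADAPTER»; LH4-p19 (g2)'s COUNT SOCKETS ★ p863807 ∕
★ p863833 — the (hF) hypothesis DISCHARGED in the socket's binder shape; CELLREAD-C.sig.v2 item (a), the (hLit) twin ★ p863983 being the template), 2026-09-05.
-/
import Summits.HodgeConjecture.HodgeConjecture.Theorems.F0P3cDyRamRowCellSocketLit            -- ★ p863983 (LH4-p16): frame conventions of the (hLit) twin; brings ★ p863914, ★ p863859 (`fixedNorm_mul ∕ _inv`), ★ p863477 (`trace_letters`)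
import Summits.HodgeConjecture.HodgeConjecture.Theorems.F0P3cDyRamRowCellDigitRealisability   -- ★ p863604 (LH4-p16): `exists_flip_of_sameClass`; brings ★ p863524 `ncard_fibre_eq_ncard_fibre_of_sphere`, ★ p863223
import HarnessLib

/-!
# Crux `H413`, line LH4 «(D-RAM) FOUR-FRAME» — STAGE-1b, row (2), the (β₂) road (R-36), (ROW-INT) ∕ ‹CORE›, K6-(a): «EQUAL LITERAL FIBRES OF A ROW CELL» — LH4-p19 (g2)'s
# COUNT-SOCKET hypothesis (hF) («the fibres of the cell over any two LITERAL digits are equinumerous») in the socket's `∀ y ∈ Rd.filter LIT, ∀ y' ∈ Rd.filter LIT, #{…y…} = #{…y'…}` shape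

Cell `hodgecm-mathlib` (D-0151), FLOOR 0, crux item H413 = `stmt-HodgeConjecture-24833`, route of record `HCCMUnconditional`; squad F0∕P3c∕LH4; lane
`--supports stmt-HodgeConjecture-24833 --as helper` (count-neutral; pays NO tier-0 row).  THEOREMS ONLY (no `def`, no instance, no notation, no `sorry`, default heartbeats);
★-only imports; states NO law; (β₂) stays a HYPOTHESIS.
WHAT.  In the currency of ★ p863914 ∕ ★ p863983 (`Vf x₀ = (κ̂(x₀) − κ₀) ∕ ξ₀`, `κ̂ = ρu₀ ∕ t`, `u₀ = h·x₀Θx₀`, `t = Tr_ρ u₀`; `CLS x₀ :≡ t(x₀) ∈ 𝒩 = {eΘe : ρe = e}`;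
`LIT V₀ :≡ |κ₀ + jE V₀·ξ₀|·|cc(α − ρα)| = |ϖE|^b ∧ Q(κ₀ + jE V₀·ξ₀) ∕ N_ρ(h) ∈ 𝒩`) the socket's (hF) reads: for any two literal digits `y, y'` of a `σ`-fixed digit system `Rd`,
`#{Λ ∣ ∃ x₀, GEN Λ x₀ ∧ (CLS x₀ ↔ ε) ∧ |Vf x₀ − jE y| ≤ r} = #{… y' …}`.  The two sphere points `κ₁ = κ₀ + jE y·ξ₀`, `κ₂ = κ₀ + jE y'·ξ₀` have `|κ₂| = |κ₁|` (both sphere clauses) and lie in ONE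
`Q`-class (both class clauses, `𝒩` a group ★ p863859), so the flip `εΘε = ρκ₂∕ρκ₁` EXISTS (★ p863604 `exists_flip_of_sameClass`, lane-C letters `_c12 ∕ _c13 ∕ _c20`) and ★ p863524
`ncard_fibre_eq_ncard_fibre_of_sphere` (ANY two sphere points; depth multiplier `μ := 0`, tolerance `r·|ξ₀|`) gives the equality; §1 is the set identity «socket fibre over `y` = ★ p863524's
fibre over `κ₀ + jE y·ξ₀`» (`(κ̂ − κ₀)∕ξ₀ − jE y = (κ̂ − κ₁)∕ξ₀`; the depth clause at `μ = 0` is vacuous), §2 the two-digit form, §3 the HEAD in the socket's binder shape (`LIT` abstract with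
the letter `hLIT : LIT V → sphere ∧ class` — ★ p863983's conclusion — so the consumer's `LIT` lambda is not re-spelled here).
WHAT IS NOT CLAIMED: (hI), (hbase), any census identity; which digits are literal (★ p863983); the precisions `r, r₀` are the (hLit) twin's (`r·|ξ₀| < R`, `r·|ξ₀| ≤ r₀·R`).
HONEST LABEL.  Count-neutral lattice bookkeeping; nothing printed is asserted; no census law is stated; `HC_CM` is proved only modulo the 7 printed citations (2 remaining named inputs:
hLiu418 = `stmt-HodgeConjecture-24832`, h413 = `stmt-HodgeConjecture-24833`) until rung 0 closes.
## References
* [Kottwitz1986BaseChangeUnits] R. E. Kottwitz, *Base change for unit elements of Hecke algebras*, Compositio Math. 60 (1986): §1 pp. 240–241 (fixed-lattice counts as orbital integrals).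
* [Flicker1998UnitaryFL] Y. Z. Flicker, *Elementary proof of the fundamental lemma for a unitary group*, Canad. J. Math. 50 (1998): Prop. 7 p. 84 (torus-orbit census).
* [Jacobowitz1962] R. Jacobowitz, *Hermitian forms over local fields*, Amer. J. Math. 84 (1962): §4 (dual lattices, gluing).
* [Serre1979] J.-P. Serre, *Local Fields*, GTM 67 (1979): Ch. III §6 Prop. 12; Ch. V §3 Cor. 3; Ch. XIV §6.
-/

set_option autoImplicit false

noncomputable section

namespace Summit.HodgeConjecture.HodgeConjecture.Cruxes.H413.F0P3cDyRamRowCellSocketFibre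

open scoped Valued WithZero
open WithZero Finset
open Literature.NumberTheory.Automorphic.UnitaryThreeFourFrame (IsRamifiedQuadraticDatum)
open Summit.HodgeConjecture.HodgeConjecture.Cruxes.H413.F0P3cDyRamToricCensusDefs
open Summit.HodgeConjecture.HodgeConjecture.Cruxes.H413.F0P3cDyRamRowVertexPopulationRead (fixedNorm_mul fixedNorm_inv)
open Summit.HodgeConjecture.HodgeConjecture.Cruxes.H413.F0P3cDyRamRowCellSphereTransport (ncard_fibre_eq_ncard_fibre_of_sphere)
open Summit.HodgeConjecture.HodgeConjecture.Cruxes.H413.F0P3cDyRamRowCellDigitRealisability (exists_flip_of_sameClass)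

variable {E M : Type} [Field E] [Valued E ℤᵐ⁰] [Field M] [Valued M ℤᵐ⁰] {ρ Θ : M →+* M} {α : M}

/-! ## §1 The socket's fibre over a digit `y` is ★ p863524's fibre over the sphere point `κ₀ + jE y·ξ₀` (depth multiplier `0`, tolerance `r·|ξ₀|`) -/

omit [Valued E ℤᵐ⁰] in
/-- **THE SOCKET FIBRE IS A SPHERE FIBRE.**  For `ξ₀ ≠ 0` and any `y : E`: the set `{Λ ∣ ∃ x₀, GEN Λ x₀ ∧ (CLS x₀ ↔ ε) ∧ |(κ̂ − κ₀)∕ξ₀ − jE y| ≤ r}` of the socket ★ p863833 equals ★ p863524's fibre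
`{Λ ∣ ∃ x₀, GEN clauses ∧ IsOrd(0 ∕ Y) ∧ (CLS x₀ ↔ ε) ∧ |κ̂ − (κ₀ + jE y·ξ₀)| ≤ r·|ξ₀|}` — `(κ̂ − κ₀)∕ξ₀ − jE y = (κ̂ − κ₁)∕ξ₀`, and the depth clause at `μ = 0` is vacuous.
[cite: Kottwitz1986BaseChangeUnits, §1 pp. 240–241] [cite: Jacobowitz1962, §4] -/
theorem socketFibre_eq_sphereFibre (jE : E →+* M) (ϖ : E) (hM : M) (j b : ℕ) {κ₀ ξ₀ : M} (hξ0 : ξ₀ ≠ 0) (r : ℤᵐ⁰) (ε : Prop) (y : E) :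
    {Λ : AddSubgroup M | ∃ x₀ : M, (x₀ ≠ 0 ∧ (∀ x, x ∈ Λ ↔ ∃ ζ, IsOrd ρ α (jE ϖ ^ j) ζ ∧ x = x₀ * ζ) ∧
        IsOrd ρ α (jE ϖ ^ j) (dualGen ρ Θ α (jE ϖ ^ j) hM x₀) ∧ ¬ IsOrd ρ α (jE ϖ ^ j) (dualGen ρ Θ α (jE ϖ ^ j) hM x₀ / jE ϖ) ∧
        Valued.v (dualGen ρ Θ α (jE ϖ ^ j) hM x₀) = Valued.v (jE ϖ) ^ b) ∧
        ((∃ e : M, ρ e = e ∧ e * Θ e = hM * (x₀ * Θ x₀) + ρ (hM * (x₀ * Θ x₀))) ↔ ε) ∧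
        Valued.v ((ρ (hM * (x₀ * Θ x₀)) / (hM * (x₀ * Θ x₀) + ρ (hM * (x₀ * Θ x₀))) - κ₀) / ξ₀ - jE y) ≤ r} =
      {Λ : AddSubgroup M | ∃ x₀ : M, x₀ ≠ 0 ∧ (∀ x, x ∈ Λ ↔ ∃ ζ, IsOrd ρ α (jE ϖ ^ j) ζ ∧ x = x₀ * ζ) ∧
        IsOrd ρ α (jE ϖ ^ j) (dualGen ρ Θ α (jE ϖ ^ j) hM x₀) ∧ ¬ IsOrd ρ α (jE ϖ ^ j) (dualGen ρ Θ α (jE ϖ ^ j) hM x₀ / jE ϖ) ∧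
        Valued.v (dualGen ρ Θ α (jE ϖ ^ j) hM x₀) = Valued.v (jE ϖ) ^ b ∧ IsOrd ρ α (jE ϖ ^ j) (0 / dualGen ρ Θ α (jE ϖ ^ j) hM x₀) ∧
        ((∃ c : M, ρ c = c ∧ c * Θ c = hM * (x₀ * Θ x₀) + ρ (hM * (x₀ * Θ x₀))) ↔ ε) ∧
        Valued.v (ρ (hM * (x₀ * Θ x₀)) / (hM * (x₀ * Θ x₀) + ρ (hM * (x₀ * Θ x₀))) - (κ₀ + jE y * ξ₀)) ≤ r * Valued.v ξ₀} := by
  have hξpos : (0 : ℤᵐ⁰) < Valued.v ξ₀ := zero_lt_iff.2 ((Valuation.ne_zero_iff _).2 hξ0)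
  -- the vacuous depth clause
  have hdep0 : ∀ x₀ : M, IsOrd ρ α (jE ϖ ^ j) (0 / dualGen ρ Θ α (jE ϖ ^ j) hM x₀) := fun x₀ => by
    rw [zero_div]
    exact ⟨by rw [Valuation.map_zero]; exact zero_le, by rw [map_zero, sub_zero, Valuation.map_zero]; exact zero_le⟩
  -- the digit clause: `(κ̂ − κ₀)∕ξ₀ − jE y = (κ̂ − (κ₀ + jE y·ξ₀))∕ξ₀`
  have hdig : ∀ κ : M, Valued.v ((κ - κ₀) / ξ₀ - jE y) ≤ r ↔ Valued.v (κ - (κ₀ + jE y * ξ₀)) ≤ r * Valued.v ξ₀ := fun κ => by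
    have e : (κ - κ₀) / ξ₀ - jE y = (κ - (κ₀ + jE y * ξ₀)) / ξ₀ := by field_simp; ring
    rw [e, map_div₀, div_le_iff₀ hξpos]
  ext Λ
  simp only [Set.mem_setOf_eq]
  refine exists_congr fun x₀ => ⟨?_, ?_⟩
  · rintro ⟨⟨hx₀, hmem, hyO, hyprim, hylev⟩, hcls, hd⟩
    exact ⟨hx₀, hmem, hyO, hyprim, hylev, hdep0 x₀, hcls, (hdig _).1 hd⟩
  · rintro ⟨hx₀, hmem, hyO, hyprim, hylev, -, hcls, hd⟩
    exact ⟨⟨hx₀, hmem, hyO, hyprim, hylev⟩, hcls, (hdig _).2 hd⟩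

/-! ## §2 Two literal digits carry equinumerous fibres -/

/-- **EQUAL FIBRES OVER TWO LITERAL DIGITS.**  One-field letters (`jE`-letters incl. `|jE a| = |a|`; `ρ, Θ` commuting involutions, `ρ` isometric; `Θh = h ≠ 0`); the cell `(j, b)` (`1 ≤ b`,
`cc(α − ρα) ≠ 0`, letter `hFgap`, `hfin`); the lane-C class letters `_c12 ∕ _c13 ∕ _c20` (`|c₀| = 1`, the `Θ`-norm dichotomy of `Θ`-fixed units, a `Θ`-fixed unit whose `ρ`-norm is not in
`𝒩`); the reference pair `(κ₀, ξ₀)` (`Tr_ρ κ₀ = 1`, `Θκ₀ = κ₀`, `ρξ₀ = −ξ₀`, `Θξ₀ = ξ₀ ≠ 0`); precisions `r, r₀` with `r·|ξ₀|·|cc(α − ρα)| < |ϖE|^b` and `r·|ξ₀|·|cc(α − ρα)| ≤ r₀·|ϖE|^b`;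
the class letter `hdeep` at depth `r₀`.  THEN for two `σ`-fixed `y, y' : E` whose sphere points `κ₀ + jE y·ξ₀`, `κ₀ + jE y'·ξ₀` satisfy the two `LIT` clauses (sphere + class) the
socket fibres over `y` and `y'` are equinumerous: flip `εΘε = ρκ₂∕ρκ₁` by ★ p863604, transport by ★ p863524 at `μ = 0`, tolerance `r·|ξ₀|`.
[cite: Kottwitz1986BaseChangeUnits, §1 pp. 240–241] [cite: Flicker1998UnitaryFL, Prop. 7 p. 84] [cite: Jacobowitz1962, §4] [cite: Serre1979, Ch. XIV §6] -/
theorem ncard_socketFibre_eq_of_lit {σ : E →+* E} {ϖ : E} {d tE : ℕ} (hD : IsRamifiedQuadraticDatum σ ϖ d tE)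
    (jE : E →+* M) (hjiso : ∀ a, Valued.v (jE a) = Valued.v a) (hjfix : ∀ z, ρ z = z ↔ ∃ c, jE c = z) (hΘj : ∀ c, Θ (jE c) = jE (σ c))
    (hρρ : ∀ x, ρ (ρ x) = x) (hvρ : ∀ x, Valued.v (ρ x) = Valued.v x) (hΘΘ : ∀ x, Θ (Θ x) = x) (hΘρ : ∀ x, Θ (ρ x) = ρ (Θ x))
    {hM : M} (hΘh : Θ hM = hM) (hh : hM ≠ 0) {j b : ℕ} (hb1 : 1 ≤ b) (hcc : jE ϖ ^ j * (α - ρ α) ≠ 0)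
    (hFgap : ∀ z : M, ρ z = z → Θ z = z → Valued.v (jE ϖ) < Valued.v z → Valued.v z ≤ 1 → Valued.v z = 1)
    (hfin : (levelSet ρ Θ α (jE ϖ) hM j b).Finite)
    {c₀ : M} (hc₀1 : Valued.v c₀ = 1)
    (hdich : ∀ x : M, Θ x = x → Valued.v x = 1 → (∃ z : M, z * Θ z = x) ∨ ∃ z : M, z * Θ z = c₀ * x)
    (hwit : ∃ a : M, Θ a = a ∧ Valued.v a = 1 ∧ ¬ ∃ e : M, ρ e = e ∧ e * Θ e = a * ρ a)
    {κ₀ ξ₀ : M} (hκ₀ : κ₀ + ρ κ₀ = 1) (hΘκ₀ : Θ κ₀ = κ₀) (hξ : ρ ξ₀ = -ξ₀) (hΘξ : Θ ξ₀ = ξ₀) (hξ0 : ξ₀ ≠ 0)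
    {r r₀ : ℤᵐ⁰} (hrR : r * Valued.v ξ₀ * Valued.v (jE ϖ ^ j * (α - ρ α)) < Valued.v (jE ϖ) ^ b)
    (hr₀ : r * Valued.v ξ₀ * Valued.v (jE ϖ ^ j * (α - ρ α)) ≤ r₀ * Valued.v (jE ϖ) ^ b)
    (hdeep : ∀ u : M, ρ u = u → Θ u = u → Valued.v (u - 1) ≤ r₀ → ∃ c : M, ρ c = c ∧ c * Θ c = u)
    (ε : Prop) {y y' : E} (hσy : σ y = y) (hσy' : σ y' = y')
    (hy : Valued.v (κ₀ + jE y * ξ₀) * Valued.v (jE ϖ ^ j * (α - ρ α)) = Valued.v (jE ϖ) ^ b ∧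
      ∃ e : M, ρ e = e ∧ e * Θ e = (κ₀ + jE y * ξ₀) * ρ (κ₀ + jE y * ξ₀) / (hM * ρ hM))
    (hy' : Valued.v (κ₀ + jE y' * ξ₀) * Valued.v (jE ϖ ^ j * (α - ρ α)) = Valued.v (jE ϖ) ^ b ∧
      ∃ e : M, ρ e = e ∧ e * Θ e = (κ₀ + jE y' * ξ₀) * ρ (κ₀ + jE y' * ξ₀) / (hM * ρ hM)) :
    {Λ : AddSubgroup M | ∃ x₀ : M, (x₀ ≠ 0 ∧ (∀ x, x ∈ Λ ↔ ∃ ζ, IsOrd ρ α (jE ϖ ^ j) ζ ∧ x = x₀ * ζ) ∧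
        IsOrd ρ α (jE ϖ ^ j) (dualGen ρ Θ α (jE ϖ ^ j) hM x₀) ∧ ¬ IsOrd ρ α (jE ϖ ^ j) (dualGen ρ Θ α (jE ϖ ^ j) hM x₀ / jE ϖ) ∧
        Valued.v (dualGen ρ Θ α (jE ϖ ^ j) hM x₀) = Valued.v (jE ϖ) ^ b) ∧
        ((∃ e : M, ρ e = e ∧ e * Θ e = hM * (x₀ * Θ x₀) + ρ (hM * (x₀ * Θ x₀))) ↔ ε) ∧
        Valued.v ((ρ (hM * (x₀ * Θ x₀)) / (hM * (x₀ * Θ x₀) + ρ (hM * (x₀ * Θ x₀))) - κ₀) / ξ₀ - jE y) ≤ r}.ncard =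
      {Λ : AddSubgroup M | ∃ x₀ : M, (x₀ ≠ 0 ∧ (∀ x, x ∈ Λ ↔ ∃ ζ, IsOrd ρ α (jE ϖ ^ j) ζ ∧ x = x₀ * ζ) ∧
        IsOrd ρ α (jE ϖ ^ j) (dualGen ρ Θ α (jE ϖ ^ j) hM x₀) ∧ ¬ IsOrd ρ α (jE ϖ ^ j) (dualGen ρ Θ α (jE ϖ ^ j) hM x₀ / jE ϖ) ∧
        Valued.v (dualGen ρ Θ α (jE ϖ ^ j) hM x₀) = Valued.v (jE ϖ) ^ b) ∧
        ((∃ e : M, ρ e = e ∧ e * Θ e = hM * (x₀ * Θ x₀) + ρ (hM * (x₀ * Θ x₀))) ↔ ε) ∧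
        Valued.v ((ρ (hM * (x₀ * Θ x₀)) / (hM * (x₀ * Θ x₀) + ρ (hM * (x₀ * Θ x₀))) - κ₀) / ξ₀ - jE y') ≤ r}.ncard := by
  obtain ⟨-, -, hϖ, -⟩ := id hD
  -- `jE ϖ`: a `ρ`-fixed non-zero element of valuation `< 1`
  have hρϖ : ρ (jE ϖ) = jE ϖ := (hjfix _).2 ⟨ϖ, rfl⟩
  have hϖlt : Valued.v (jE ϖ) < 1 := by rw [hjiso, hϖ, ← exp_zero, exp_lt_exp]; norm_num
  have hvϖ0 : Valued.v (jE ϖ) ≠ 0 := by rw [hjiso, hϖ]; exact exp_ne_zero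
  have hϖ0 : jE ϖ ≠ 0 := (Valuation.ne_zero_iff _).1 hvϖ0
  have hρj : ∀ c' : E, ρ (jE c') = jE c' := fun c' => (hjfix _).2 ⟨c', rfl⟩
  have hccpos : (0 : ℤᵐ⁰) < Valued.v (jE ϖ ^ j * (α - ρ α)) := zero_lt_iff.2 ((Valuation.ne_zero_iff _).2 hcc)
  -- the two sphere points
  set κ₁ : M := κ₀ + jE y * ξ₀ with hκ₁def
  set κ₂ : M := κ₀ + jE y' * ξ₀ with hκ₂def
  obtain ⟨hR₁, hQ₁⟩ := hy
  obtain ⟨hR₂, hQ₂⟩ := hy'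
  have hκ₁tr : κ₁ + ρ κ₁ = 1 := by rw [hκ₁def, map_add, map_mul, hρj, hξ, ← hκ₀]; ring
  have hκ₂tr : κ₂ + ρ κ₂ = 1 := by rw [hκ₂def, map_add, map_mul, hρj, hξ, ← hκ₀]; ring
  have hΘκ₁ : Θ κ₁ = κ₁ := by rw [hκ₁def, map_add, map_mul, hΘj, hσy, hΘκ₀, hΘξ]
  have hΘκ₂ : Θ κ₂ = κ₂ := by rw [hκ₂def, map_add, map_mul, hΘj, hσy', hΘκ₀, hΘξ]
  have hκ₂v : Valued.v κ₂ = Valued.v κ₁ := mul_right_cancel₀ hccpos.ne' (by rw [hR₂, hR₁])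
  have hvκ₁ : Valued.v κ₁ ≠ 0 := fun h0 => by rw [h0, zero_mul] at hR₁; exact pow_ne_zero _ hvϖ0 hR₁.symm
  have hκ₁0 : κ₁ ≠ 0 := (Valuation.ne_zero_iff _).1 hvκ₁
  have hpos₁ : (0 : ℤᵐ⁰) < Valued.v κ₁ := zero_lt_iff.2 hvκ₁
  -- the two points lie in one `Q`-class: `Q(κ₂)∕Q(κ₁) = (Q(κ₂)∕N_ρ h)·(Q(κ₁)∕N_ρ h)⁻¹ ∈ 𝒩`
  have hNh0 : hM * ρ hM ≠ 0 := mul_ne_zero hh ((map_ne_zero ρ).2 hh)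
  have hQ : ∃ e : M, ρ e = e ∧ e * Θ e = (κ₂ * ρ κ₂) / (κ₁ * ρ κ₁) := by
    have e : (κ₂ * ρ κ₂) / (κ₁ * ρ κ₁) = ((κ₂ * ρ κ₂) / (hM * ρ hM)) * ((κ₁ * ρ κ₁) / (hM * ρ hM))⁻¹ := by
      rw [← div_eq_mul_inv, div_div_div_cancel_right₀ hNh0]
    rw [e]
    exact fixedNorm_mul hQ₂ (fixedNorm_inv hQ₁)
  -- the flip exists (★ p863604)
  obtain ⟨εf, hεf⟩ := exists_flip_of_sameClass hρρ hvρ hΘρ hc₀1 hdich hwit hΘκ₁ hΘκ₂ hκ₁0 hκ₂v hQ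
  -- the precision letters at tolerance `r·|ξ₀|`
  have hr : r * Valued.v ξ₀ < Valued.v κ₁ := lt_of_mul_lt_mul_right (by rw [hR₁]; exact hrR) hccpos.le
  have hrr₀ : r * Valued.v ξ₀ ≤ r₀ * Valued.v κ₁ := le_of_mul_le_mul_right (by rw [mul_assoc r₀, hR₁]; exact hr₀) hccpos
  have hΔle : Valued.v (κ₂ - κ₁) ≤ Valued.v κ₁ := (Valuation.map_sub _ _ _).trans (max_le hκ₂v.le le_rfl)
  have hrτ : Valued.v (κ₂ - κ₁) * (r * Valued.v ξ₀) ≤ r₀ * Valued.v κ₁ ^ 2 :=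
    calc Valued.v (κ₂ - κ₁) * (r * Valued.v ξ₀) ≤ Valued.v κ₁ * (r₀ * Valued.v κ₁) := mul_le_mul' hΔle hrr₀
      _ = r₀ * Valued.v κ₁ ^ 2 := by rw [pow_two, mul_left_comm]
  have hμ : Valued.v (0 : M) ≤ (Valued.v (jE ϖ) ^ b) ^ 2 := by rw [Valuation.map_zero]; exact zero_le
  -- ★ p863524 at `μ = 0`, read through §1
  rw [socketFibre_eq_sphereFibre (ρ := ρ) (Θ := Θ) (α := α) jE ϖ hM j b hξ0 r ε y,
    socketFibre_eq_sphereFibre (ρ := ρ) (Θ := Θ) (α := α) jE ϖ hM j b hξ0 r ε y']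
  exact ncard_fibre_eq_ncard_fibre_of_sphere (α := α) (μ := (0 : M)) hρρ hvρ hΘΘ hΘρ hΘh hρϖ hϖ0 hϖlt hb1 hcc hμ hFgap hdeep hκ₁tr hκ₂tr hΘκ₁ hΘκ₂
    hR₁ hκ₂v hr hrτ hεf ε hfin

/-! ## §3 HEAD — (hF) in socket shape -/

/-- **HEAD — (hF) «THE FIBRES OVER ANY TWO LITERAL DIGITS ARE EQUINUMEROUS», SOCKET SHAPE.**  Letters of §2, a digit system `Rd` of `σ`-fixed elements, and an abstract literal predicate
`LIT` with the letter `hLIT : ∀ V ∈ Rd, LIT V → (sphere ∧ class)` (★ p863983's conclusion for the consumer's `LIT`).  THEN the (hF) hypothesis of ★ p863833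
`cellDiff_eq_zero_of_fibration_reads₃` ∕ ★ p863807 VERBATIM, with `CLS x₀ :≡ ∃ e, ρe = e ∧ eΘe = t(x₀)`, `Vf x₀ :≡ (κ̂(x₀) − κ₀) ∕ ξ₀` (★ p863914's instantiations):
`∀ y ∈ Rd.filter LIT, ∀ y' ∈ Rd.filter LIT, #{Λ ∣ ∃ x₀, GEN Λ x₀ ∧ (CLS x₀ ↔ ε) ∧ |Vf x₀ − jE y| ≤ r} = #{… y' …}`.
[cite: Kottwitz1986BaseChangeUnits, §1 pp. 240–241] [cite: Flicker1998UnitaryFL, Prop. 7 p. 84] [cite: Jacobowitz1962, §4] [cite: Serre1979, Ch. V §3 Cor. 3; Ch. XIV §6] -/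
theorem fibre_ncard_eq_of_lit_of_gen {σ : E →+* E} {ϖ : E} {d tE : ℕ} (hD : IsRamifiedQuadraticDatum σ ϖ d tE)
    (jE : E →+* M) (hjiso : ∀ a, Valued.v (jE a) = Valued.v a) (hjfix : ∀ z, ρ z = z ↔ ∃ c, jE c = z) (hΘj : ∀ c, Θ (jE c) = jE (σ c))
    (hρρ : ∀ x, ρ (ρ x) = x) (hvρ : ∀ x, Valued.v (ρ x) = Valued.v x) (hΘΘ : ∀ x, Θ (Θ x) = x) (hΘρ : ∀ x, Θ (ρ x) = ρ (Θ x))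
    {hM : M} (hΘh : Θ hM = hM) (hh : hM ≠ 0) {j b : ℕ} (hb1 : 1 ≤ b) (hcc : jE ϖ ^ j * (α - ρ α) ≠ 0)
    (hFgap : ∀ z : M, ρ z = z → Θ z = z → Valued.v (jE ϖ) < Valued.v z → Valued.v z ≤ 1 → Valued.v z = 1)
    (hfin : (levelSet ρ Θ α (jE ϖ) hM j b).Finite)
    {c₀ : M} (hc₀1 : Valued.v c₀ = 1)
    (hdich : ∀ x : M, Θ x = x → Valued.v x = 1 → (∃ z : M, z * Θ z = x) ∨ ∃ z : M, z * Θ z = c₀ * x)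
    (hwit : ∃ a : M, Θ a = a ∧ Valued.v a = 1 ∧ ¬ ∃ e : M, ρ e = e ∧ e * Θ e = a * ρ a)
    {κ₀ ξ₀ : M} (hκ₀ : κ₀ + ρ κ₀ = 1) (hΘκ₀ : Θ κ₀ = κ₀) (hξ : ρ ξ₀ = -ξ₀) (hΘξ : Θ ξ₀ = ξ₀) (hξ0 : ξ₀ ≠ 0)
    {r r₀ : ℤᵐ⁰} (hrR : r * Valued.v ξ₀ * Valued.v (jE ϖ ^ j * (α - ρ α)) < Valued.v (jE ϖ) ^ b)
    (hr₀ : r * Valued.v ξ₀ * Valued.v (jE ϖ ^ j * (α - ρ α)) ≤ r₀ * Valued.v (jE ϖ) ^ b)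
    (hdeep : ∀ u : M, ρ u = u → Θ u = u → Valued.v (u - 1) ≤ r₀ → ∃ c : M, ρ c = c ∧ c * Θ c = u)
    (ε : Prop) (Rd : Finset E) (hRdσ : ∀ V ∈ Rd, σ V = V) (LIT : E → Prop) [DecidablePred LIT]
    (hLIT : ∀ V ∈ Rd, LIT V → Valued.v (κ₀ + jE V * ξ₀) * Valued.v (jE ϖ ^ j * (α - ρ α)) = Valued.v (jE ϖ) ^ b ∧
      ∃ e : M, ρ e = e ∧ e * Θ e = (κ₀ + jE V * ξ₀) * ρ (κ₀ + jE V * ξ₀) / (hM * ρ hM)) :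
    ∀ y ∈ Rd.filter LIT, ∀ y' ∈ Rd.filter LIT,
      {Λ : AddSubgroup M | ∃ x₀ : M, (x₀ ≠ 0 ∧ (∀ x, x ∈ Λ ↔ ∃ ζ, IsOrd ρ α (jE ϖ ^ j) ζ ∧ x = x₀ * ζ) ∧
        IsOrd ρ α (jE ϖ ^ j) (dualGen ρ Θ α (jE ϖ ^ j) hM x₀) ∧ ¬ IsOrd ρ α (jE ϖ ^ j) (dualGen ρ Θ α (jE ϖ ^ j) hM x₀ / jE ϖ) ∧
        Valued.v (dualGen ρ Θ α (jE ϖ ^ j) hM x₀) = Valued.v (jE ϖ) ^ b) ∧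
        ((∃ e : M, ρ e = e ∧ e * Θ e = hM * (x₀ * Θ x₀) + ρ (hM * (x₀ * Θ x₀))) ↔ ε) ∧
        Valued.v ((ρ (hM * (x₀ * Θ x₀)) / (hM * (x₀ * Θ x₀) + ρ (hM * (x₀ * Θ x₀))) - κ₀) / ξ₀ - jE y) ≤ r}.ncard =
      {Λ : AddSubgroup M | ∃ x₀ : M, (x₀ ≠ 0 ∧ (∀ x, x ∈ Λ ↔ ∃ ζ, IsOrd ρ α (jE ϖ ^ j) ζ ∧ x = x₀ * ζ) ∧
        IsOrd ρ α (jE ϖ ^ j) (dualGen ρ Θ α (jE ϖ ^ j) hM x₀) ∧ ¬ IsOrd ρ α (jE ϖ ^ j) (dualGen ρ Θ α (jE ϖ ^ j) hM x₀ / jE ϖ) ∧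
        Valued.v (dualGen ρ Θ α (jE ϖ ^ j) hM x₀) = Valued.v (jE ϖ) ^ b) ∧
        ((∃ e : M, ρ e = e ∧ e * Θ e = hM * (x₀ * Θ x₀) + ρ (hM * (x₀ * Θ x₀))) ↔ ε) ∧
        Valued.v ((ρ (hM * (x₀ * Θ x₀)) / (hM * (x₀ * Θ x₀) + ρ (hM * (x₀ * Θ x₀))) - κ₀) / ξ₀ - jE y') ≤ r}.ncard := by
  intro y hy y' hy'
  obtain ⟨hyR, hyL⟩ := mem_filter.1 hy
  obtain ⟨hyR', hyL'⟩ := mem_filter.1 hy'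
  exact ncard_socketFibre_eq_of_lit (α := α) hD jE hjiso hjfix hΘj hρρ hvρ hΘΘ hΘρ hΘh hh hb1 hcc hFgap hfin hc₀1 hdich hwit hκ₀ hΘκ₀ hξ hΘξ hξ0 hrR hr₀ hdeep ε
    (hRdσ y hyR) (hRdσ y' hyR') (hLIT y hyR hyL) (hLIT y' hyR' hyL')

end Summit.HodgeConjecture.HodgeConjecture.Cruxes.H413.F0P3cDyRamRowCellSocketFibre

end
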